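import Summits.HodgeConjecture.HodgeConjecture.Theorems.WeilTypeLadderDegenerationUp
import Summits.HodgeConjecture.HodgeConjecture.Theorems.WeilTypeLadderOnPath
import Literature.AlgebraicGeometry.HodgeTheory.WeilClassesAnchorEngine
import HarnessLib

/-!
# WeilTypeLadder · the ANCHOR ENGINE made hyperbolicity-free: local clause ∧ family reach ⟹ Weil plane algebraic

b2b cell `hweil` (packet `run/shared/lean/b2b/hodge-weil/`, `LADDER.md ## CARVER — v4`, C25–C27; DIVERGENCE D13).
Carver, generation 4. TYPING ONLY — nothing is asserted, no `sorry`, every input is a hypothesis BY NAME.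

`Theorems/WeilTypeLadderLocalAnchor.lean` (prover 2, gen 3) proves
`weilClasses_algebraic_hyperbolic_of_localAnchor`: `HasLocallyAlgebraicWeilAnchor n d` ∧
`weilFamilyReach_hyperbolic` ⟹ the Weil plane of every HYPERBOLIC (`det H = -1`) `√-d`-Weil abelian `2n`-fold is
algebraic. Inspection of that proof shows that hyperbolicity (`IsHyperbolicWeilType`) is used at exactly two
places: to unpack the anchor and to FEED the reach fact. The mechanism itself — W-engine, rationality along the
section, the LOCAL clause at the anchor, Baire/countable-union (LOCAL ⟹ GLOBAL), Lefschetz `(1,1)` + Kleiman for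
`Hⁿ`, one-class-suffices, isogeny transfer — never looks at the discriminant. This file records that observation
as a typed, kernel-checked ENGINE over the two carrier predicates of
`Literature/AlgebraicGeometry/HodgeTheory/WeilClassesAnchorEngine.lean` (same seat; real definitions, verbatim
sub-formulae), in which neither hyperbolicity nor the Weil operator of the anchor occurs:

* `WeilAnchorLocalClause n d P h w` — the local clause of `HasLocallyAlgebraicWeilAnchor` with the anchor data
  `(P, h, w)` as parameters (`h : H²(P)`, `w : H^{2n}(P)` arbitrary classes): along EVERY smooth projective
  abelian-fibred (with `ℤ[√-d]`-action) family over a smooth irreducible quasi-projective base with quasi-projective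
  total space, all global `H` (fibrewise rational `(1,1)`) and `W` (fibrewise rational `(n,n)`) with
  `e'^*(H_{s₀}) = h`, `e'^*(W_{s₀}) = w` at a chart `e' : P ≅ 𝒳_{s₀}` admit an open `U ∋ s₀` and `q ∈ ℚ` with
  `(q·Hⁿ + W)|_{𝒳_s}` algebraic for `s ∈ U`. VERBATIM the clause of the Literature predicate (p177378), so that
  `hasLocallyAlgebraicWeilAnchor_iff` is `Iff.rfl`.
* `WeilFamilyReaches n d P h w A φ` — the CONCLUSION shape of `weilFamilyReach_hyperbolic` with the same
  abstraction: a smooth projective abelian-fibred `ℤ[√-d]`-family `f : 𝒳 → S` (closed in `ℙᴺ × S`, `S` smooth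
  irreducible quasi-projective) through a chart `e' : P ≅ 𝒳_{s₀}` with a global fibrewise-rational `(1,1)` class `H`,
  `e'^*(H_{s₀}) = h`, a continuous fibrewise-`(n,n)` section `σ` with `σ(s₀) = e'^{-1*} w`, and a fibre
  `𝒳_{s₁} ≅ A'` `K`-isogenous to `(A, φ)` on which `σ(s₁)` is a NON-ZERO class of the Weil plane of `(A', φ')`.
  VERBATIM the fact's `∃`-block, so that `weilFamilyReaches_of_reach_hyperbolic` is a direct application.

Declarations (namespace `Summit.HodgeConjecture.HodgeConjecture.WeilTypeLadder`):

* `weilClasses_algebraic_of_localClause_of_reaches` — THE ENGINE: `IsRationalClass w` ∧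
  `WeilAnchorLocalClause n d P h w` ∧ `WeilFamilyReaches n d P h w A φ` (`n, d ≥ 1`, `A.dim = 2n`, `φ ≫ φ = -d`)
  ⟹ `weilClassesOf A φ n d ≤ algebraicClasses A.X n`. Proof = the gen-3 proof with the two unpackings removed
  (same landed lemmas, same order).
* Faithfulness: with `hasLocallyAlgebraicWeilAnchor_iff` (`Iff.rfl`) and `weilFamilyReaches_of_reach_hyperbolic`
  (Literature, same seat) the gen-3 theorem `weilClasses_algebraic_hyperbolic_of_localAnchor` follows from the engine
  in three lines (`obtain` the anchor from `hL`; apply the engine to `weilFamilyReaches_of_reach_hyperbolic hF …`); it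
  is not restated here (it is landed: `Theorems/WeilTypeLadderLocalAnchor.lean`).
* `weilClassesOf_le_algebraicClasses_of_reached` — the engine on the δ-FREE engine-input node
  `WeilReachedFromLocalAnchor n d A φ := ∃ (P, h, w), IsRationalClass w ∧ WeilAnchorLocalClause n d P h w ∧
  WeilFamilyReaches n d P h w A φ` ("`(A, φ)` is reached by a Weil family from some locally algebraic anchor").
* EDGES TO THE RUNGS (kernel, unconditional implications; the hypotheses are the open content):
  `nonsplitSixfolds_of_reached` (R1′ ⟸ every NON-hyperbolic sixfold is reached),
  `weilSixfolds_of_reached` (R1 = stmt-HodgeConjecture-2524 ⟸ every sixfold is reached),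
  `weilClassesImaginaryQuadratic_of_reached` (R∞ ⟸ every `2n`-fold, `n ≥ 2`, is reached),
  `weilSixfolds_of_floor_of_nonsplit_reached` (R1 ⟸ F0a ∧ every non-hyperbolic sixfold is reached — the
  "second door" to stmt-2524 next to `weilSixfolds_of_reach_of_localAnchor_four`, which needs a dimension-8 SPLIT
  anchor and is obstructed for Markman's toolbox by the Euler-form barrier
  `Literature/…/SemiregularityEulerFormBarrier.lean`, prover 1 gen 4).

WHY δ-FREE MATTERS (DIVERGENCE D13). The non-split components of the moduli of `√-d`-Weil abelian `2n`-folds are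
indexed by `det H ∈ ℚˣ/N(Kˣ)` (Landherr 1936; van Geemen 1994, 5.2–5.4); the tree's real carriers have NO
discriminant class (the abstract `Motives.weilDiscriminant` is not connected to `complexBetti`), so a reach FACT
"same `(n, K, det H)` ⟹ same component" cannot yet be rendered. The node `WeilReachedFromLocalAnchor n d A φ`
quantifies the anchor EXISTENTIALLY PER TARGET, so the discriminant bookkeeping is pushed entirely into its future
discharge (a Landherr/Deligne reach fact per component, refereed, once `det H` is on carriers — plus ONE locally
algebraic anchor per component, e.g. at a product point `X⁴ × S²`: Schoen 1998 §10, Markman 2509.23403 §11.5,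
the cell's `b2b-hweil-pv3-g3/PRODUCT-LOCI.md`), while the engine and the edges to the rungs are settled now.
These nodes are ENGINE INPUTS, not rungs: they are not cases of the Hodge conjecture (their family half is a
moduli statement the tree does not construct), so they carry no `_of_HodgeConjecture` lemma; the rungs they feed
(R1′, R1, R∞) have theirs (`Theorems/WeilTypeLadderOnPath.lean`).

Sorry-free; no definition, no new notion (the predicates live in Literature); serves stmt-HodgeConjecture-2524
without closing it (the edges are implications between registered rungs and engine-input hypotheses BY NAME).
[cite: Deligne1982HodgeCycles, proof of Thm. 4.8 (pp. 47–52)] [cite: vanGeemen1994HodgeAV, 5.2–5.4, 5.8–5.11]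
[cite: Landherr1936HermitianForms, Satz] [cite: Markman2025SecantWeil, proof of Thm. 1.5.1 (§9.3)]
[cite: CharlesSchnell2014Notes, Prop. 11.3.11 (proof)] [cite: Schoen1998HodgeWeilAddendum, §10]
-/

-- every declaration of this problem lives in `Summit.HodgeConjecture.HodgeConjecture.…` (summit = sub-problem)
set_option linter.dupNamespace false

noncomputable section

open CategoryTheory AlgebraicGeometry Limits MonoidalCategory CartesianMonoidalCategory

namespace Summit.HodgeConjecture.HodgeConjecture.WeilTypeLadder

open Literature.AlgebraicGeometry Literature.AlgebraicGeometry.Motives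
open Literature.AlgebraicGeometry.HodgeTheory
open Literature.AlgebraicTopology.SingularHomology
open Summit.HodgeConjecture.HodgeConjecture.Theorems.HeckePrymWeilLine
  (stub_rationalAlongSection stub_isogenyTransfer owf_isoTransport)
open Summit.HodgeConjecture.HodgeConjecture.Theorems.HyperbolicEightfoldsSqrtMinus7.TensorAnchor
  (stub_globalClassEngine)
open Summit.HodgeConjecture.HodgeConjecture.Theorems.HyperbolicEightfoldsSqrtMinus7.AnchorObject
  (complexBetti_map_cupPowTwo cupPowTwo_mem_algebraicClasses_abelian)

/-! ## The engine -/

/-- **THE ANCHOR ENGINE (hyperbolicity-free).** Let `n, d ≥ 1`, `(A, φ)` an abelian `2n`-fold with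
`φ ≫ φ = -d`, and `(P, h, w)` anchor data with `w` RATIONAL, satisfying the local clause
`WeilAnchorLocalClause n d P h w`, such that a Weil family from `(P, h, w)` reaches `(A, φ)`
(`WeilFamilyReaches`). Then the Weil plane of `(A, φ)` is algebraic. Mechanism (all landed, kernel-checked):
W-engine `stub_globalClassEngine` globalises the section `σ` to `W ∈ H^{2n}(𝒳)`; `stub_rationalAlongSection`
makes `σ` rational everywhere; the LOCAL clause gives `U ∋ s₀`, `q` with `(q·Hⁿ + W)|_{𝒳_s}` algebraic on `U`;
the Baire lemma `mem_algebraicClasses_of_isOpen_subset_algebraicityLocus` (Charles–Schnell countable union of closed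
algebraic subsets + Baire + Mumford's curve lemma) spreads it to EVERY fibre, in particular `𝒳_{s₁} ≅ A'`;
`H_{s₁}ⁿ` is algebraic on `A'` (Lefschetz `(1,1)`, discharged, + Kleiman); hence `W_{s₁} = σ(s₁)` is a non-zero
algebraic class of the Weil plane of `(A', φ')`; ONE CLASS SUFFICES
(`weilClassesOf_le_algebraicClasses_iff_exists_ne_zero_of_dim_eq`, unconditional); isogeny transfer
`stub_isogenyTransfer`. This is `weilClasses_algebraic_hyperbolic_of_localAnchor` (prover 2, gen 3) with the two
uses of hyperbolicity (anchor unpacking, feeding the reach fact) moved to the caller: the discriminant of the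
component never enters. [cite: Markman2025SecantWeil, proof of Thm. 1.5.1 (§9.3), last paragraph]
[cite: Deligne1982HodgeCycles, proof of Thm. 4.8] [cite: CharlesSchnell2014Notes, Prop. 11.3.11 (proof)]
[cite: vanGeemen1994HodgeAV, proof of Thm. 6.12] -/
theorem weilClasses_algebraic_of_localClause_of_reaches (n d : ℕ) (hn : 1 ≤ n) (hd : 1 ≤ d)
    (P : AbelianVariety ℂ) (h : complexBetti P.X 2) (w : complexBetti P.X (2 * n))
    (hwrat : IsRationalClass w) (hloc : WeilAnchorLocalClause n d P h w)
    (A : AbelianVariety ℂ) (φ : A ⟶ A) (hA : A.dim = 2 * n) (hφ : φ ≫ φ = -(d • 𝟙 A))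
    (hR : WeilFamilyReaches n d P h w A φ) :
    weilClassesOf A φ n d ≤ algebraicClasses A.X n := by
  -- `n = m + 1`
  obtain ⟨m, rfl⟩ : ∃ m, n = m + 1 := ⟨n - 1, by omega⟩
  -- the reaching family
  obtain ⟨𝒳, S, f, s₀, s₁, e', A', φ', e₁, σ, H, hfam, hemb, hirr, hsm, hSqp, hchart, hHfib, hHs₀, hσc, hpt, hσH,
      hσ₀, hA'dim, hφ'A, ⟨u, v, m', hm', huv, hu, hv⟩, w₁, hσ₁, hw₁W, hw₁0⟩ := hR
  haveI := hirr
  -- the total space is quasi-projective (closed in `ℙᴺ × S`)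
  have h𝒳qp : IsQuasiProjectiveOver 𝒳 := by
    obtain ⟨N, ι, hι, -⟩ := hemb
    haveI := hι
    exact IsQuasiProjectiveOver.of_isClosedImmersion_projectiveSpace_tensor ι hSqp
  -- the W-engine: `σ` is the restriction of a global class `W`
  obtain ⟨W, hWσ⟩ := stub_globalClassEngine f (2 * (m + 1)) (2 * (m + 1)) hfam hemb hsm hSqp hirr σ hσc hpt
  have hcls : ∀ (s : ComplexPoints S) (y : complexBetti (fiberOver f s) (2 * (m + 1))),
      σ s = ⟨s, y⟩ → complexBetti.map (fiberι f s) (2 * (m + 1)) W = y := by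
    intro s y hy
    have h' := (hWσ s).symm.trans hy
    simp only [globalSection, FiberClass.mk.injEq, heq_eq_eq, true_and] at h'
    exact h'
  have hW₀ : complexBetti.map (fiberι f s₀) (2 * (m + 1)) W = complexBetti.map e'.inv (2 * (m + 1)) w :=
    hcls s₀ _ hσ₀
  have hW₁ : complexBetti.map (fiberι f s₁) (2 * (m + 1)) W = w₁ := hcls s₁ _ hσ₁
  -- rationality along the section (landed), Hodge type along the section (from the reach datum)
  have hrat₀ : IsRationalClass (σ s₀).cls := by rw [hσ₀]; exact hwrat.map _
  have hratσ : ∀ s, IsRationalClass (σ s).cls :=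
    stub_rationalAlongSection f (2 * (m + 1)) (2 * (m + 1)) hfam hsm hSqp hirr σ hσc hpt s₀ hrat₀
  have hWfib : ∀ s, IsRationalClass (complexBetti.map (fiberι f s) (2 * (m + 1)) W) ∧
      IsOfHodgeType (2 * (m + 1)) (fiberOver f s) (2 * (m + 1)) (m + 1) (m + 1)
        (complexBetti.map (fiberι f s) (2 * (m + 1)) W) := by
    intro s
    have h1 := hratσ s
    have h2 := hσH s
    rw [hWσ s] at h1 h2
    exact ⟨h1, h2⟩
  -- the anchor condition at `s₀` for `W`: `e'^*(W|_{s₀}) = w`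
  have hWs₀ : complexBetti.map e'.hom (2 * (m + 1)) (complexBetti.map (fiberι f s₀) (2 * (m + 1)) W) = w := by
    rw [hW₀, e'.complexBetti_map_hom_map_inv]
  -- THE LOCAL CLAUSE: an open `U ∋ s₀` of algebraic fibres for `q • Hⁿ + W`
  obtain ⟨U, q, hUo, hs₀U, hUalg⟩ :=
    hloc f hfam h𝒳qp hSqp hirr hsm hchart H W hHfib hWfib s₀ e' hHs₀ hWs₀
  -- the global class `q • Hⁿ + W` and its fibre restrictions
  set B : complexBetti 𝒳 (2 * (m + 1)) := ((q : ℚ) : ℂ) • cupPowTwo H (m + 1) + W with hBdef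
  have hBres : ∀ s, complexBetti.map (fiberι f s) (2 * (m + 1)) B =
      ((q : ℚ) : ℂ) • cupPowTwo (complexBetti.map (fiberι f s) 2 H) (m + 1) +
        complexBetti.map (fiberι f s) (2 * (m + 1)) W := by
    intro s
    rw [hBdef, map_add, map_smul, complexBetti_map_cupPowTwo]
  have hUalgB : ∀ t ∈ U, complexBetti.map (fiberι f t) (2 * (m + 1)) B ∈ algebraicClasses (fiberOver f t) (m + 1) :=
    fun t ht => by rw [hBres t]; exact hUalg t ht
  -- GLOBAL from LOCAL: Baire + countable union of closed algebraic subsets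
  have hBall : ∀ t : ComplexPoints S,
      complexBetti.map (fiberι f t) (2 * (m + 1)) B ∈ algebraicClasses (fiberOver f t) (m + 1) :=
    mem_algebraicClasses_of_isOpen_subset_algebraicityLocus f h𝒳qp hSqp hsm hfam B hUo ⟨s₀, hs₀U⟩ hUalgB
  have halg : ((q : ℚ) : ℂ) • cupPowTwo (complexBetti.map (fiberι f s₁) 2 H) (m + 1) +
      complexBetti.map (fiberι f s₁) (2 * (m + 1)) W ∈ algebraicClasses (fiberOver f s₁) (m + 1) := by
    rw [← hBres s₁]; exact hBall s₁
  -- `H_{s₁}ⁿ` is algebraic on `𝒳_{s₁}`: Lefschetz (1,1) + Kleiman on the abelian `A' ≅ 𝒳_{s₁}`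
  have hA'sp : IsSmoothProjective (2 * (m + 1)) A'.X := by
    have h' := AbelianVariety.isSmoothProjective_holds (A := A')
    rw [AbelianVariety.isSmoothProjective, hA'dim] at h'
    exact h'
  have hh₁alg : complexBetti.map e₁.hom 2 (complexBetti.map (fiberι f s₁) 2 H) ∈ algebraicClasses A'.X 1 :=
    lefschetzOneOne_rational_holds hA'sp _ ((hHfib s₁).1.map _) ((hHfib s₁).2.map_of_iso e₁)
  have hh₁n : complexBetti.map e₁.hom (2 * (m + 1)) (cupPowTwo (complexBetti.map (fiberι f s₁) 2 H) (m + 1)) ∈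
      algebraicClasses A'.X (m + 1) := by
    rw [complexBetti_map_cupPowTwo]
    exact cupPowTwo_mem_algebraicClasses_abelian A' hh₁alg m
  have hHn : cupPowTwo (complexBetti.map (fiberι f s₁) 2 H) (m + 1) ∈ algebraicClasses (fiberOver f s₁) (m + 1) :=
    owf_isoTransport _ A' e₁ (m + 1) _ hh₁n
  -- hence `W_{s₁} = w₁` is algebraic on `𝒳_{s₁}`
  have hW₁alg : w₁ ∈ algebraicClasses (fiberOver f s₁) (m + 1) := by
    rw [← hW₁]
    have h' := Submodule.sub_mem _ halg (Submodule.smul_mem _ (((q : ℚ) : ℂ)) hHn)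
    rwa [add_sub_cancel_left] at h'
  -- a NON-ZERO ALGEBRAIC class of the Weil plane of `A'`: one class suffices (unconditional)
  have hw₁alg : complexBetti.map e₁.hom (2 * (m + 1)) w₁ ∈ algebraicClasses A'.X (m + 1) :=
    Theorems.isoInvariance_proof e₁ (m + 1) _ hW₁alg
  have hA'alg : weilClassesOf A' φ' (m + 1) d ≤ algebraicClasses A'.X (m + 1) :=
    (weilClassesOf_le_algebraicClasses_iff_exists_ne_zero_of_dim_eq abelianVarietyCohomologyExteriorH1_holds
      hA'dim (Nat.succ_pos m) hd hφ'A).mpr ⟨_, hw₁W, hw₁alg, hw₁0⟩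
  -- isogeny transfer `A → A'` (landed)
  have hφℤ : φ ≫ φ = -((d : ℤ) • 𝟙 A) := by rw [hφ, natCast_zsmul]
  exact stub_isogenyTransfer d (m + 1) A A' φ φ' hA hA'dim hφℤ u v m' hm' huv hu hv hA'alg

/-! ## The δ-free engine-input node and the edges to the rungs -/

/-- The engine, by name, on the node: a reached `(A, φ)` (`n, d ≥ 1`, `A.dim = 2n`, `φ ≫ φ = -d`) has algebraic
Weil plane. -/
theorem weilClassesOf_le_algebraicClasses_of_reached (n d : ℕ) (hn : 1 ≤ n) (hd : 1 ≤ d)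
    (A : AbelianVariety ℂ) (φ : A ⟶ A) (hA : A.dim = 2 * n) (hφ : φ ≫ φ = -(d • 𝟙 A))
    (hR : WeilReachedFromLocalAnchor n d A φ) :
    weilClassesOf A φ n d ≤ algebraicClasses A.X n := by
  obtain ⟨P, h, w, hwrat, hloc, hreach⟩ := hR
  exact weilClasses_algebraic_of_localClause_of_reaches n d hn hd P h w hwrat hloc A φ hA hφ hreach

/-- **R1′ (`NonsplitSixfolds`) ⟸ every NON-hyperbolic `√-d`-Weil sixfold is reached from a locally algebraic
anchor** (the "second door" to the sixfold rungs: non-split anchors in dimension 6, e.g. at product points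
`X⁴ × S²` — Schoen 1998 §10, Markman 2509.23403 §11.5 — instead of a split anchor in dimension 8).
[cite: Schoen1998HodgeWeilAddendum, §10] [cite: vanGeemen1994HodgeAV, 5.2–5.4] -/
theorem nonsplitSixfolds_of_reached
    (h : ∀ d : ℕ, 0 < d → ∀ (A : AbelianVariety ℂ) (φ : A ⟶ A), A.dim = 2 * 3 → φ ≫ φ = -(d • 𝟙 A) →
      (∀ (e : ProjectiveEmbedding A.X) (a : complexBetti (projectiveSpace e.n ℂ) 2),
        IsRationalClass a → a ≠ 0 →
          ¬ IsHyperbolicWeilType A φ 3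
            ((d : ℂ) • complexBetti.map e.ι 2 a + complexBetti.map φ.hom.hom.hom 2 (complexBetti.map e.ι 2 a))) →
      WeilReachedFromLocalAnchor 3 d A φ) :
    NonsplitSixfolds := by
  intro d hd A φ hA _ hφ hns c _ _ hcW
  exact weilClassesOf_le_algebraicClasses_of_reached 3 d (by norm_num) hd A φ hA hφ (h d hd A φ hA hφ hns) hcW

/-- **R1 (`WeilSixfolds` = stmt-HodgeConjecture-2524) ⟸ every `√-d`-Weil sixfold is reached from a locally
algebraic anchor.** [cite: Deligne1982HodgeCycles, proof of Thm. 4.8] [cite: Schoen1998HodgeWeilAddendum, §10] -/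
theorem weilSixfolds_of_reached
    (h : ∀ d : ℕ, 0 < d → ∀ (A : AbelianVariety ℂ) (φ : A ⟶ A), A.dim = 2 * 3 → φ ≫ φ = -(d • 𝟙 A) →
      WeilReachedFromLocalAnchor 3 d A φ) :
    Theses.SevenfoldWeilCensus.WeilSixfolds := by
  refine weilSixfolds_iff_weilClassesOf.2 ?_
  intro d hd A φ hA _ hφ c _ _ hcW
  exact weilClassesOf_le_algebraicClasses_of_reached 3 d (by norm_num) hd A φ hA hφ (h d hd A φ hA hφ) hcW

/-- **R∞ (`WeilClassesImaginaryQuadratic`) ⟸ every `√-d`-Weil abelian `2n`-fold, `n ≥ 2`, is reached from a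
locally algebraic anchor.** [cite: Deligne1982HodgeCycles, proof of Thm. 4.8] [cite: vanGeemen1994HodgeAV, 5.2–5.11] -/
theorem weilClassesImaginaryQuadratic_of_reached
    (h : ∀ n : ℕ, 2 ≤ n → ∀ d : ℕ, 0 < d → ∀ (A : AbelianVariety ℂ) (φ : A ⟶ A), A.dim = 2 * n →
      φ ≫ φ = -(d • 𝟙 A) → WeilReachedFromLocalAnchor n d A φ) :
    WeilClassesImaginaryQuadratic := by
  intro n hn d hd A φ hA _ hφ c _ _ hcW
  exact weilClassesOf_le_algebraicClasses_of_reached n d (by omega) hd A φ hA hφ (h n hn d hd A φ hA hφ) hcW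

/-- **The second door to stmt-2524: R1 ⟸ F0a (split sixfolds, the floor) ∧ every NON-hyperbolic sixfold is
reached from a locally algebraic anchor** (R1 ⟸ F0a ∧ R1′: `weilSixfolds_of_nonsplitSixfolds_of_floor`,
`Theorems/WeilTypeLadderOnPath.lean`; here composed directly by the case split hyperbolic / not). Compare `weilSixfolds_of_reach_of_localAnchor_four` (prover 2, gen 3): ONE split anchor in
dimension 8 per `d` — obstructed for Markman's secant toolbox by the Euler-form barrier on abelian fourfolds
(`Literature/AlgebraicGeometry/HodgeTheory/SemiregularityEulerFormBarrier.lean`). [claim: Markman2025SecantWeil,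
status: under-review] [cite: Schoen1998HodgeWeilAddendum, §10] -/
theorem weilSixfolds_of_floor_of_nonsplit_reached (hF0a : Markman2025_weilClasses_algebraic_hyperbolicSixfold)
    (h : ∀ d : ℕ, 0 < d → ∀ (A : AbelianVariety ℂ) (φ : A ⟶ A), A.dim = 2 * 3 → φ ≫ φ = -(d • 𝟙 A) →
      (∀ (e : ProjectiveEmbedding A.X) (a : complexBetti (projectiveSpace e.n ℂ) 2),
        IsRationalClass a → a ≠ 0 →
          ¬ IsHyperbolicWeilType A φ 3
            ((d : ℂ) • complexBetti.map e.ι 2 a + complexBetti.map φ.hom.hom.hom 2 (complexBetti.map e.ι 2 a))) →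
      WeilReachedFromLocalAnchor 3 d A φ) :
    Theses.SevenfoldWeilCensus.WeilSixfolds := by
  refine weilSixfolds_iff_weilClassesOf.2 ?_
  intro d hd A φ hA hAsp hφ c hc hH hcW
  by_cases hsplit : ∃ (e : ProjectiveEmbedding A.X) (a : complexBetti (projectiveSpace e.n ℂ) 2),
      IsRationalClass a ∧ a ≠ 0 ∧
        IsHyperbolicWeilType A φ 3
          ((d : ℂ) • complexBetti.map e.ι 2 a + complexBetti.map φ.hom.hom.hom 2 (complexBetti.map e.ι 2 a))
  · obtain ⟨e, a, ha, ha0, hhyp⟩ := hsplit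
    exact hF0a d hd A φ hA hAsp hφ e a ha ha0 hhyp c hc hH hcW
  · exact nonsplitSixfolds_of_reached h d hd A φ hA hAsp hφ
      (fun e a ha ha0 hhyp => hsplit ⟨e, a, ha, ha0, hhyp⟩) c hc hH hcW

end Summit.HodgeConjecture.HodgeConjecture.WeilTypeLadder

end
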